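import Mathlib
import HarnessLib

/-!
# Abstract discrete entropy Gronwall over windows (stub S7a)

Helper file (`--supports stmt-AtomisticToContinuum-15145`) proving the registered stub
`stub_discreteEntropyGronwall` of the lead's skeleton for the crux
`Summit.AtomisticToContinuum.HydrodynamicLimit.Theses.TwoClocks.ClampedEntropyClock`
(line `IdeatorTwoSketch`). This is the purely real-analytic telescoping + discrete Gronwall step of
Yau's relative-entropy clock: nonnegative quantities `H N s` with `H N 0 / (N+1) → 0`; for every
`ε > 0` there are window lengths `w N > 0` and `N₀` such that for `N ≥ N₀` one full window costs
`H N (s + w N) ≤ (1 + A·w N) H N s + w N (N+1) ε` (windows inside `[0, t]`) and the last partial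
window costs `H N t ≤ H N s + (N+1) ε` (`t - w N ≤ s ≤ t`). Then `H N t / (N+1) → 0`.

Proof summary. Fix `ε > 0`, get `w, N₀`; for `N ≥ N₀` put `K := ⌊t / w N⌋₊` and the grid
`s_k := k · w N`, `k ≤ K`, so `K · w N ≤ t < (K+1) · w N`. Iterating the full-window step along the
grid (`gronwall_iterate_le`) gives `H N s_K ≤ (1 + A w N)^K (H N 0 + K w N (N+1) ε)`, and
`(1 + A w N)^K ≤ exp (A w N)^K = exp (K A w N) ≤ exp (A t)`; the partial-window clause at `s = s_K`
then yields `H N t / (N+1) ≤ exp (A t) (H N 0 / (N+1) + t ε) + ε`, which is eventually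
`≤ (exp (A t) (1 + t) + 1) ε` by `H N 0 / (N+1) → 0`. Since `ε` is arbitrary and `H ≥ 0`, the claim follows.
-/

noncomputable section

open Filter Topology

namespace Summit.AtomisticToContinuum.HydrodynamicLimit.Theorems.QuenchedCellClock

/-- Iterated one-step affine recursion (discrete Gronwall, crude form): if `0 ≤ a`, `0 ≤ b` and
`G (k+1) ≤ (1 + a) G k + b` for all `k < K`, then `G k ≤ (1 + a)^k (G 0 + k b)` for all `k ≤ K`.
[folklore] -/
theorem gronwall_iterate_le (G : ℕ → ℝ) {a b : ℝ} (ha : 0 ≤ a) (hb : 0 ≤ b)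
    (K : ℕ) (hrec : ∀ k, k < K → G (k + 1) ≤ (1 + a) * G k + b) :
    ∀ k, k ≤ K → G k ≤ (1 + a) ^ k * (G 0 + k * b) := by
  intro k
  induction k with
  | zero =>
    intro _
    simp
  | succ k ih =>
    intro hk
    have hk' : k < K := hk
    have h1 : G k ≤ (1 + a) ^ k * (G 0 + k * b) := ih hk'.le
    have h2 : G (k + 1) ≤ (1 + a) * G k + b := hrec k hk'
    have h1a : (1 : ℝ) ≤ 1 + a := by linarith
    have hpow1 : (1 : ℝ) ≤ (1 + a) ^ (k + 1) := one_le_pow₀ h1a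
    have hb' : b ≤ (1 + a) ^ (k + 1) * b := by
      have := mul_le_mul_of_nonneg_right hpow1 hb
      linarith
    have h3 : (1 + a) * G k ≤ (1 + a) * ((1 + a) ^ k * (G 0 + k * b)) :=
      mul_le_mul_of_nonneg_left h1 (by linarith)
    calc G (k + 1) ≤ (1 + a) * G k + b := h2
      _ ≤ (1 + a) * ((1 + a) ^ k * (G 0 + k * b)) + (1 + a) ^ (k + 1) * b := by linarith
      _ = (1 + a) ^ (k + 1) * (G 0 + ((k + 1 : ℕ) : ℝ) * b) := by
        push_cast
        ring

/-- The one-`N` estimate behind `stub_discreteEntropyGronwall`: if on `[0, t]` a nonnegative `F` satisfies the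
full-window step `F (s + w) ≤ (1 + A w) F s + w M ε` (`0 ≤ s`, `s + w ≤ t`) and the partial-window bound
`F t ≤ F s + M ε` (`0 ≤ s ≤ t ≤ s + w`) for some window `w > 0`, rate `A ≥ 0`, `M > 0`, `ε ≥ 0`, then
`F t ≤ exp (A t) (F 0 + t M ε) + M ε`. [folklore] -/
theorem window_gronwall_bound (F : ℝ → ℝ) {t A w M ε : ℝ} (ht : 0 < t) (hA : 0 ≤ A) (hw : 0 < w)
    (hM : 0 < M) (hε : 0 ≤ ε) (hF0 : ∀ s, 0 ≤ F s)
    (hfull : ∀ s : ℝ, 0 ≤ s → s + w ≤ t → F (s + w) ≤ (1 + A * w) * F s + w * M * ε)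
    (hpart : ∀ s : ℝ, 0 ≤ s → s ≤ t → t ≤ s + w → F t ≤ F s + M * ε) :
    F t ≤ Real.exp (A * t) * (F 0 + t * M * ε) + M * ε := by
  set K := ⌊t / w⌋₊ with hK_def
  have hKle : (K : ℝ) * w ≤ t := by
    have : (K : ℝ) ≤ t / w := Nat.floor_le (div_nonneg ht.le hw.le)
    rwa [le_div_iff₀ hw] at this
  have hKlt : t ≤ (K : ℝ) * w + w := by
    have : t / w < (K : ℝ) + 1 := Nat.lt_floor_add_one _
    rw [div_lt_iff₀ hw] at this
    linarith
  -- the grid recursion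
  have hrec : ∀ k, k < K →
      F (((k + 1 : ℕ) : ℝ) * w) ≤ (1 + A * w) * F ((k : ℝ) * w) + w * M * ε := by
    intro k hk
    have hs0 : 0 ≤ (k : ℝ) * w := by positivity
    have hs1 : (k : ℝ) * w + w ≤ t := by
      have hk1 : (k : ℝ) + 1 ≤ K := by exact_mod_cast hk
      have : ((k : ℝ) + 1) * w ≤ (K : ℝ) * w := mul_le_mul_of_nonneg_right hk1 hw.le
      linarith
    have := hfull _ hs0 hs1
    push_cast
    rw [add_mul, one_mul]
    exact this
  have hiter := gronwall_iterate_le (fun k => F ((k : ℝ) * w)) (a := A * w) (b := w * M * ε)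
    (by positivity) (by positivity) K hrec K le_rfl
  simp only [Nat.cast_zero, zero_mul] at hiter
  -- `(1 + A w)^K ≤ exp (A t)`
  have hpow : (1 + A * w) ^ K ≤ Real.exp (A * t) := by
    calc (1 + A * w) ^ K ≤ Real.exp (A * w) ^ K :=
          pow_le_pow_left₀ (by positivity) (by linarith [Real.add_one_le_exp (A * w)]) K
      _ = Real.exp (K * (A * w)) := by rw [← Real.exp_nat_mul]
      _ ≤ Real.exp (A * t) := by
          apply Real.exp_le_exp_of_le
          have : A * ((K : ℝ) * w) ≤ A * t := mul_le_mul_of_nonneg_left hKle hA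
          nlinarith [this]
  -- assemble
  have hgrid : F ((K : ℝ) * w) ≤ Real.exp (A * t) * (F 0 + t * M * ε) := by
    have h1 : F 0 + (K : ℝ) * (w * M * ε) ≤ F 0 + t * M * ε := by
      have : (K : ℝ) * w * (M * ε) ≤ t * (M * ε) :=
        mul_le_mul_of_nonneg_right hKle (by positivity)
      nlinarith [this]
    have h0 : 0 ≤ F 0 + (K : ℝ) * (w * M * ε) := by
      have := hF0 0
      positivity
    calc F ((K : ℝ) * w) ≤ (1 + A * w) ^ K * (F 0 + (K : ℝ) * (w * M * ε)) := hiter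
      _ ≤ Real.exp (A * t) * (F 0 + (K : ℝ) * (w * M * ε)) := mul_le_mul_of_nonneg_right hpow h0
      _ ≤ Real.exp (A * t) * (F 0 + t * M * ε) :=
          mul_le_mul_of_nonneg_left h1 (Real.exp_pos _).le
  have hlast := hpart ((K : ℝ) * w) (by positivity) hKle hKlt
  linarith

/-- **Stub S7a — abstract discrete entropy Gronwall over windows.** Nonnegative quantities
`H N s` with `H N 0 / (N+1) → 0`; for every `ε > 0` there are window lengths `w N > 0` and `N₀` such that for
`N ≥ N₀` one full window costs `H N (s + w N) ≤ (1 + A·w N) H N s + w N (N+1) ε` (grid windows inside `[0, t]`)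
and the last partial window costs `H N t ≤ H N s + (N+1) ε` (`t - w N ≤ s ≤ t`). Then `H N t / (N+1) → 0`:
iterate over `K = ⌊t / w N⌋` windows, `(1 + A w)^K ≤ e^{A t}`, so `H N t ≤ e^{At}(H N 0 + t (N+1) ε) + (N+1) ε`.
[cite: Yau1991, §2] -/
theorem stub_discreteEntropyGronwall (H : ℕ → ℝ → ℝ) {t A : ℝ} (ht : 0 < t) (hA : 0 ≤ A)
    (hH0 : ∀ N s, 0 ≤ H N s)
    (hzero : Tendsto (fun N : ℕ => H N 0 / ((N : ℝ) + 1)) atTop (𝓝 0))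
    (hstep : ∀ ε : ℝ, 0 < ε → ∃ w : ℕ → ℝ, (∀ N, 0 < w N) ∧
      ∃ N₀ : ℕ, ∀ N : ℕ, N₀ ≤ N →
        (∀ s : ℝ, 0 ≤ s → s + w N ≤ t →
          H N (s + w N) ≤ (1 + A * w N) * H N s + w N * ((N : ℝ) + 1) * ε) ∧
        (∀ s : ℝ, 0 ≤ s → s ≤ t → t ≤ s + w N → H N t ≤ H N s + ((N : ℝ) + 1) * ε)) :
    Tendsto (fun N : ℕ => H N t / ((N : ℝ) + 1)) atTop (𝓝 0) := by
  -- the one-`N` bound, eventually in `N`, for each `ε > 0`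
  have key : ∀ ε : ℝ, 0 < ε → ∀ᶠ N : ℕ in atTop,
      H N t / ((N : ℝ) + 1) ≤ Real.exp (A * t) * (H N 0 / ((N : ℝ) + 1) + t * ε) + ε := by
    intro ε hε
    obtain ⟨w, hw, N₀, hN₀⟩ := hstep ε hε
    refine Filter.eventually_atTop.2 ⟨N₀, fun N hN => ?_⟩
    obtain ⟨hfull, hpart⟩ := hN₀ N hN
    have hM : (0 : ℝ) < (N : ℝ) + 1 := by positivity
    have hb := window_gronwall_bound (H N) ht hA (hw N) hM hε.le (hH0 N) hfull hpart
    rw [div_le_iff₀ hM]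
    have : (Real.exp (A * t) * (H N 0 / ((N : ℝ) + 1) + t * ε) + ε) * ((N : ℝ) + 1) =
        Real.exp (A * t) * (H N 0 + t * ((N : ℝ) + 1) * ε) + ((N : ℝ) + 1) * ε := by
      field_simp
    rw [this]
    exact hb
  -- conclude
  rw [Metric.tendsto_atTop]
  intro δ hδ
  set C : ℝ := Real.exp (A * t) * (1 + t) + 1 with hC_def
  obtain ⟨ε, hε, hεC⟩ : ∃ ε : ℝ, 0 < ε ∧ C * ε < δ := exists_pos_mul_lt hδ C
  have h2 : ∀ᶠ N : ℕ in atTop, H N 0 / ((N : ℝ) + 1) < ε := hzero.eventually (gt_mem_nhds hε)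
  obtain ⟨N₁, hN₁⟩ := Filter.eventually_atTop.1 ((key ε hε).and h2)
  refine ⟨N₁, fun N hN => ?_⟩
  obtain ⟨ha, hb⟩ := hN₁ N hN
  rw [Real.dist_eq, sub_zero, abs_of_nonneg (div_nonneg (hH0 N t) (by positivity))]
  have hexp : 0 ≤ Real.exp (A * t) := (Real.exp_pos _).le
  calc H N t / ((N : ℝ) + 1) ≤ Real.exp (A * t) * (H N 0 / ((N : ℝ) + 1) + t * ε) + ε := ha
    _ ≤ Real.exp (A * t) * (ε + t * ε) + ε := by
        have : H N 0 / ((N : ℝ) + 1) + t * ε ≤ ε + t * ε := by linarith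
        have := mul_le_mul_of_nonneg_left this hexp
        linarith
    _ = C * ε := by rw [hC_def]; ring
    _ < δ := hεC

end Summit.AtomisticToContinuum.HydrodynamicLimit.Theorems.QuenchedCellClock
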